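import Summits.QuantumFields.GaugeBoot.BesselCap
import Summits.QuantumFields.GaugeBoot.Rung0D4Binding
import Summits.QuantumFields.YangMills.Theorems.Instrument.BesselRatioEnclosures
import Literature.Analysis.FunctionSpaces.BesselIQuotientMonotone
import HarnessLib

/-!
# YM instrument cell — `SU(2)`, `D = 4`: the a-priori BESSEL CAP at the Q-A1 couplings (A-plan-11; family file)

Cell `ym-instrument` (HUMAN RULING D-0084 (2); director-ym R138; HOME `run/shared/lean/pub/ym-instrument/`), crew (a),
Lean typist seat `ym-instrument-boot-lean-1`. Question Q-A1 (`pub/ym-instrument/QUESTIONS.md`), amendments A-plan-10 and A-plan-11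
«BESSEL CAP» (boot-plan; proof refereed by boot-ref as LIMIT-SOUNDNESS P.5, PASS 2026-08-26T22:45:31Z, ADDENDUM 23:22:03Z;
constant of record A-plan-11 v2 §2, LEAD A-0826-35 (3)); ladder consequence: the «| cap» rows of TABLE-A1 (IR
`stmt-QuantumFields-19354`, THE NUMBER; cards `cruxidea-stmt-QuantumFields-19354-4` and `-6`) lose their named hypothesis
`hBesselCap(ρ)` once bound through this file.

HONEST FRAMING (page 1 of every file of this cell): WHAT IS CERTIFIED HERE, AT WHICH `(G, D, L, β)`: `G = SU(2)`
(fundamental representation, STANDARD Wilson action `S = β_std Σ_P (1 − ½ Re tr U_P)`, tree coupling `β_std/2`), `D = 4`,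
EVERY periodic lattice `(ℤ/L)⁴` with `L ≥ 2` (even or odd), `β_std ∈ {1, 3/2, 9/5, 2, 11/5, 12/5}` and, with a Bessel-ratio
hypothesis at `6β`, every `β_std ≥ 0`: for a lattice word `w` read from the origin and a finite set `F` of torus links, each
traversed EXACTLY ONCE by `w`, no two read by a common plaquette, `|⟨W_0(w)⟩_{(ℤ/L)⁴, β}| ≤ ρ(β)^{|F|}` with the RATIONAL
`ρ(β)` of record (`488/625, 1059/1250, 2177/2500, 2207/2500, 558/625, 9013/10000` — the 4-dp upward roundings of the Amos
bound at `x = 6β`; here checked DIRECTLY against `I₂(6β)/I₁(6β)` by crew (b)'s exact-rational kernel checker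
`BesselRatioEnclosures.besselRatioCheck`, plus the tree's monotonicity of `I₂/I₁`). Source theorem:
`GaugeBoot.abs_wilsonExpectation_wordLoop_le_pow` (file `GaugeBoot/BesselCap`). An elementary, fixed-coupling,
`R`-independent perimeter-type bound (explicit-rate `SU(2)` instance of Simon–Yaffe 1982); NOT an area law, NOT a string
tension, NOT a mass gap, nothing about a continuum limit or large `N`; nothing here is summit-bearing. No hypothesis about
Bessel functions is left to the reader in the per-`β` theorems; the two torus-side hypotheses (once-read, no shared
plaquette) are checked per row by the binding files.
-/

noncomputable section

namespace Summit.QuantumFields.YangMills.Theorems.Instrument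

open Summit.QuantumFields.GaugeBoot
open Literature.MathematicalPhysics.QuantumFieldTheory
open Literature.Analysis.FunctionSpaces (besselI strictMonoOn_besselI_two_div_one)
open BesselRatioEnclosures (besselRatioCheck besselRatioCheck_sound)

/-! ## The Bessel-ratio hypothesis of the cap from one point value (monotonicity of `I₂/I₁`) -/

/-- **Monotone transfer**: `I₂(6β)/I₁(6β) ≤ ρ` (one point) gives `I₂(y)/I₁(y) ≤ ρ` on `0 < y ≤ 6β` (tree
`strictMonoOn_besselI_two_div_one`, Segura 2011). [folklore] -/
theorem besselRatio_le_of_le_at {β ρ : ℝ} (hβ : 0 < β) (hρ : besselI 2 (6 * β) / besselI 1 (6 * β) ≤ ρ) :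
    ∀ y : ℝ, 0 < y → y ≤ 6 * β → besselI 2 y / besselI 1 y ≤ ρ := by
  intro y hy hyle
  refine le_trans ?_ hρ
  exact (strictMonoOn_besselI_two_div_one.monotoneOn) hy (by positivity : (0 : ℝ) < 6 * β) hyle

/-- The range `2t · 2(D−1)` of the source theorem at `D = 4`, `t = β/2` is `6β`. [folklore] -/
theorem range_eq (β : ℝ) : 2 * (β / (2 : ℕ)) * ((2 * (4 - 1) : ℕ) : ℝ) = 6 * β := by norm_num; ring

/-! ## The cap at `(SU(2), D = 4, β)` for an admissible link set, general `β` -/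

/-- **THE BESSEL CAP, `SU(2)`, `D = 4`, general `β ≥ 0` with a point hypothesis at `6β`.** For every torus `(ℤ/L)⁴` with
`L ≥ 2`, every word `w` read from the origin and every finite set `F` of links that `w` traverses exactly once each and no
two of which are read by a common plaquette: `|⟨W_0(w)⟩_β| ≤ ρ^{|F|}` whenever `0 ≤ ρ` and `I₂(6β)/I₁(6β) ≤ ρ`
(`Rung0D4.W β L w = ⟨W_0(w)⟩` at standard coupling `β`, tree coupling `β/2`). [folklore] -/
theorem abs_W_le_pow_of_besselRatio_le {β ρ : ℝ} (hβ : 0 < β) (hρ0 : 0 ≤ ρ)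
    (hρ : besselI 2 (6 * β) / besselI 1 (6 * β) ≤ ρ) (L : ℕ) [NeZero L] (hL : 1 < L) (w : Word 4)
    (F : Finset (Edge 4 L)) (hF1 : ∀ e ∈ F, (Word.edgesRead (0 : Site 4 L) w).count e = 1)
    (hF2 : ∀ e ∈ F, ∀ e' ∈ F, e ≠ e' → ¬ SharePlaquette e e') :
    |Rung0D4.W β L w| ≤ ρ ^ F.card := by
  unfold Rung0D4.W
  refine abs_wilsonExpectation_wordLoop_le_pow hL (t := β / (2 : ℕ)) (by positivity) 0 w F hF1 hF2 hρ0 fun y hy hyle => ?_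
  rw [range_eq] at hyle
  exact besselRatio_le_of_le_at hβ hρ y hy hyle

/-! ## The constants of record (A-plan-11 v2 §2), checked in the kernel against `I₂(6β)/I₁(6β)` -/

/-- `I₂/I₁(6) ≤ 488/625` (`β = 1`; `I₂/I₁(6) = 0.76272…`). [folklore] -/
theorem besselRatio_six_le : besselI 2 (6 * (1 : ℝ)) / besselI 1 (6 * (1 : ℝ)) ≤ 488 / 625 := by
  have h := (besselRatioCheck_sound (n := 2) (m := 1) (x := 6) (lo := 0) (hi := 488 / 625) (Kn := 24) (Km := 24)
    (by decide +kernel)).2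
  norm_num at h ⊢
  exact h

/-- `I₂/I₁(9) ≤ 1059/1250` (`β = 3/2`; `0.83857…`). [folklore] -/
theorem besselRatio_nine_le : besselI 2 (6 * ((3 : ℝ) / 2)) / besselI 1 (6 * ((3 : ℝ) / 2)) ≤ 1059 / 1250 := by
  have h := (besselRatioCheck_sound (n := 2) (m := 1) (x := 9) (lo := 0) (hi := 1059 / 1250) (Kn := 28) (Km := 28)
    (by decide +kernel)).2
  norm_num at h ⊢
  exact h

/-- `I₂/I₁(54/5) ≤ 2177/2500` (`β = 9/5`; `0.86466…`). [folklore] -/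
theorem besselRatio_b9o5_le : besselI 2 (6 * ((9 : ℝ) / 5)) / besselI 1 (6 * ((9 : ℝ) / 5)) ≤ 2177 / 2500 := by
  have h := (besselRatioCheck_sound (n := 2) (m := 1) (x := 54 / 5) (lo := 0) (hi := 2177 / 2500) (Kn := 30) (Km := 30)
    (by decide +kernel)).2
  norm_num at h ⊢
  exact h

/-- `I₂/I₁(12) ≤ 2207/2500` (`β = 2`; `0.87784…`). [folklore] -/
theorem besselRatio_b2_le : besselI 2 (6 * (2 : ℝ)) / besselI 1 (6 * (2 : ℝ)) ≤ 2207 / 2500 := by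
  have h := (besselRatioCheck_sound (n := 2) (m := 1) (x := 12) (lo := 0) (hi := 2207 / 2500) (Kn := 30) (Km := 30)
    (by decide +kernel)).2
  norm_num at h ⊢
  exact h

/-- `I₂/I₁(66/5) ≤ 558/625` (`β = 11/5`; `0.88869…`). [folklore] -/
theorem besselRatio_b11o5_le : besselI 2 (6 * ((11 : ℝ) / 5)) / besselI 1 (6 * ((11 : ℝ) / 5)) ≤ 558 / 625 := by
  have h := (besselRatioCheck_sound (n := 2) (m := 1) (x := 66 / 5) (lo := 0) (hi := 558 / 625) (Kn := 32) (Km := 32)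
    (by decide +kernel)).2
  norm_num at h ⊢
  exact h

/-- `I₂/I₁(72/5) ≤ 9013/10000` (`β = 12/5`; `0.89778…`). [folklore] -/
theorem besselRatio_b12o5_le : besselI 2 (6 * ((12 : ℝ) / 5)) / besselI 1 (6 * ((12 : ℝ) / 5)) ≤ 9013 / 10000 := by
  have h := (besselRatioCheck_sound (n := 2) (m := 1) (x := 72 / 5) (lo := 0) (hi := 9013 / 10000) (Kn := 34) (Km := 34)
    (by decide +kernel)).2
  norm_num at h ⊢
  exact h

/-! ## The hypothesis-free caps at the six couplings -/

/-- **BESSEL CAP at `β_std = 9/5`** (`SU(2)`, `D = 4`, every torus `L ≥ 2`): `|⟨W_0(w)⟩| ≤ (2177/2500)^{|F|}` for every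
admissible link set `F` of the word `w`. [folklore] -/
theorem besselCap_SU2_D4_b9o5 (L : ℕ) [NeZero L] (hL : 1 < L) (w : Word 4) (F : Finset (Edge 4 L))
    (hF1 : ∀ e ∈ F, (Word.edgesRead (0 : Site 4 L) w).count e = 1)
    (hF2 : ∀ e ∈ F, ∀ e' ∈ F, e ≠ e' → ¬ SharePlaquette e e') :
    |Rung0D4.W (9 / 5) L w| ≤ (2177 / 2500 : ℝ) ^ F.card :=
  abs_W_le_pow_of_besselRatio_le (by norm_num) (by norm_num) besselRatio_b9o5_le L hL w F hF1 hF2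

/-- **BESSEL CAP at `β_std = 2`**: `|⟨W_0(w)⟩| ≤ (2207/2500)^{|F|}`. [folklore] -/
theorem besselCap_SU2_D4_b2 (L : ℕ) [NeZero L] (hL : 1 < L) (w : Word 4) (F : Finset (Edge 4 L))
    (hF1 : ∀ e ∈ F, (Word.edgesRead (0 : Site 4 L) w).count e = 1)
    (hF2 : ∀ e ∈ F, ∀ e' ∈ F, e ≠ e' → ¬ SharePlaquette e e') :
    |Rung0D4.W 2 L w| ≤ (2207 / 2500 : ℝ) ^ F.card :=
  abs_W_le_pow_of_besselRatio_le (by norm_num) (by norm_num) besselRatio_b2_le L hL w F hF1 hF2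

/-- **BESSEL CAP at `β_std = 11/5`**: `|⟨W_0(w)⟩| ≤ (558/625)^{|F|}`. [folklore] -/
theorem besselCap_SU2_D4_b11o5 (L : ℕ) [NeZero L] (hL : 1 < L) (w : Word 4) (F : Finset (Edge 4 L))
    (hF1 : ∀ e ∈ F, (Word.edgesRead (0 : Site 4 L) w).count e = 1)
    (hF2 : ∀ e ∈ F, ∀ e' ∈ F, e ≠ e' → ¬ SharePlaquette e e') :
    |Rung0D4.W (11 / 5) L w| ≤ (558 / 625 : ℝ) ^ F.card :=
  abs_W_le_pow_of_besselRatio_le (by norm_num) (by norm_num) besselRatio_b11o5_le L hL w F hF1 hF2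

/-- **BESSEL CAP at `β_std = 12/5`**: `|⟨W_0(w)⟩| ≤ (9013/10000)^{|F|}`. [folklore] -/
theorem besselCap_SU2_D4_b12o5 (L : ℕ) [NeZero L] (hL : 1 < L) (w : Word 4) (F : Finset (Edge 4 L))
    (hF1 : ∀ e ∈ F, (Word.edgesRead (0 : Site 4 L) w).count e = 1)
    (hF2 : ∀ e ∈ F, ∀ e' ∈ F, e ≠ e' → ¬ SharePlaquette e e') :
    |Rung0D4.W (12 / 5) L w| ≤ (9013 / 10000 : ℝ) ^ F.card :=
  abs_W_le_pow_of_besselRatio_le (by norm_num) (by norm_num) besselRatio_b12o5_le L hL w F hF1 hF2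

/-- **BESSEL CAP at `β_std = 1`**: `|⟨W_0(w)⟩| ≤ (488/625)^{|F|}`. [folklore] -/
theorem besselCap_SU2_D4_b1 (L : ℕ) [NeZero L] (hL : 1 < L) (w : Word 4) (F : Finset (Edge 4 L))
    (hF1 : ∀ e ∈ F, (Word.edgesRead (0 : Site 4 L) w).count e = 1)
    (hF2 : ∀ e ∈ F, ∀ e' ∈ F, e ≠ e' → ¬ SharePlaquette e e') :
    |Rung0D4.W 1 L w| ≤ (488 / 625 : ℝ) ^ F.card :=
  abs_W_le_pow_of_besselRatio_le (by norm_num) (by norm_num) besselRatio_six_le L hL w F hF1 hF2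

/-- **BESSEL CAP at `β_std = 3/2`**: `|⟨W_0(w)⟩| ≤ (1059/1250)^{|F|}`. [folklore] -/
theorem besselCap_SU2_D4_b3o2 (L : ℕ) [NeZero L] (hL : 1 < L) (w : Word 4) (F : Finset (Edge 4 L))
    (hF1 : ∀ e ∈ F, (Word.edgesRead (0 : Site 4 L) w).count e = 1)
    (hF2 : ∀ e ∈ F, ∀ e' ∈ F, e ≠ e' → ¬ SharePlaquette e e') :
    |Rung0D4.W (3 / 2) L w| ≤ (1059 / 1250 : ℝ) ^ F.card :=
  abs_W_le_pow_of_besselRatio_le (by norm_num) (by norm_num) besselRatio_nine_le L hL w F hF1 hF2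

end Summit.QuantumFields.YangMills.Theorems.Instrument

end
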